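import Mathlib
import HarnessLib
import Summits.Ventures.LatticeQCDFlow.Scaling.AutoregressiveGaugeUniformRateExact

/-!
# LatticeQCDFlow / Scaling — the exact worst-case mixing profile of the two exact gauge samplers: at time `t`
# every start and event is `ε`-close to the target IFF `(1 − A(cold))^t ≤ ε`

HONEST FRAMING: exact (Metropolis-corrected) sampling algorithms for lattice gauge theory;
figures of merit are autocorrelation/cost numbers at stated couplings and volumes; no
continuum-physics claim.

Venture `LatticeQCDFlow` (cell pub-lqcd), topic `Scaling`, FANOUT row 30 (lean-1, GEN-28) — OUR WORK on
THEORY-2.md §4 row C5.  `AutoregressiveGaugeUniformRateExact`: for both exact samplers every start and event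
satisfy `|μK^t(A) − π(A)| ≤ (1 − A(cold))^t`, and the cold start attains it on `{cold}` (atom-free Haar).  Read
as a mixing profile (no `def`: the worst case is spelled out as a universally quantified bound):

* **`heatBath_worstCase_le_iff`** — one-plaquette heat bath (`w(1) = M`, `d ≥ 1`, Haar without atoms): for every
  `t` and `ε`, (every initial law and every event deviate from `π` by at most `ε` at time `t`) IFF
  `(1 − Z/(c^{#B} M^k))^t ≤ ε` — the worst-case total-variation error at time `t` is EXACTLY `(1 − Z/(c^{#B} M^k))^t`,
  so the `ε`-mixing time is exactly the least `t` with `(1 − Z/(c^{#B} M^k))^t ≤ ε`, of order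
  `(c^{#B} M^k/Z)·log(1/ε)`;
* **`allClosing_worstCase_le_iff`** — the same for the all-closing conditioner with `Z/∏_{ℓ∈T} c_{#C_ℓ}`.

NOT CLAIMED: profiles from other starts (the cold start is the worst one; warm starts may be faster).
No `def`, no `sorry`, nothing cited as a fact beyond the tree.
-/

noncomputable section

namespace Summit.Ventures.LatticeQCDFlow.Theory2.Autoregressive

open MeasureTheory ProbabilityTheory Function Finset Summit.Ventures.LatticeQCDFlow.Exactness
open Literature.MathematicalPhysics.QuantumFieldTheory Literature.MathematicalPhysics.QuantumLattice
open scoped ENNReal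

variable {d L : ℕ} [NeZero L] {G : Type*} [Group G] [TopologicalSpace G] [IsTopologicalGroup G]
  [CompactSpace G] [SecondCountableTopology G] [MeasurableSpace G] [BorelSpace G]

/-- **THE EXACT WORST-CASE MIXING PROFILE OF THE ONE-PLAQUETTE HEAT BATH**: at time `t`, every start and every
event are `ε`-close to `π` iff `(1 − Z/(c^{#B} M^k))^t ≤ ε`. [ours] -/
theorem heatBath_worstCase_le_iff [MeasurableSingletonClass G] [NullSingletonClass (haarProbability G)]
    (hd : 0 < d) (hL : 2 ≤ L) {w : G → ℝ} (hw : Continuous w) {m M : ℝ} (hm0 : 0 < m)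
    (hm : ∀ g, m ≤ w g) (hM : ∀ g, w g ≤ M) (hw1 : w 1 = M)
    (B : Finset (Plaquette d L)) (t : Plaquette d L → Edge d L)
    (ht : ∀ p ∈ B, t p ∈ ({(p.1, p.2.1.1), (p.1.shift p.2.1.1, p.2.1.2),
        (p.1.shift p.2.1.2, p.2.1.1), (p.1, p.2.1.2)} : Finset (Edge d L)))
    (rank : Plaquette d L → ℕ)
    (hrank : ∀ p ∈ B, ∀ p' ∈ B, p ≠ p' → t p ∈ ({(p'.1, p'.2.1.1), (p'.1.shift p'.2.1.1, p'.2.1.2),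
        (p'.1.shift p'.2.1.2, p'.2.1.1), (p'.1, p'.2.1.2)} : Finset (Edge d L)) → rank p < rank p')
    (π q : Measure (GaugeConfig d L G)) [IsProbabilityMeasure π] [IsProbabilityMeasure q]
    (hπ : π = (Measure.pi fun _ : Edge d L => haarProbability G).withDensity fun U =>
      ENNReal.ofReal ((∏ p : Plaquette d L, w (plaquetteHolonomy U p.1 p.2.1.1 p.2.1.2)) /
        ∫ V, ∏ p : Plaquette d L, w (plaquetteHolonomy V p.1 p.2.1.1 p.2.1.2)
          ∂(Measure.pi fun _ : Edge d L => haarProbability G)))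
    (hq : q = (Measure.pi fun _ : Edge d L => haarProbability G).withDensity fun U =>
      ENNReal.ofReal ((∏ p ∈ B, w (plaquetteHolonomy U p.1 p.2.1.1 p.2.1.2)) /
        ∫ V, ∏ p ∈ B, w (plaquetteHolonomy V p.1 p.2.1.1 p.2.1.2)
          ∂(Measure.pi fun _ : Edge d L => haarProbability G))) (n : ℕ) (ε : ℝ) :
    (∀ (μ : Measure (GaugeConfig d L G)) [IsProbabilityMeasure μ] (A : Set (GaugeConfig d L G)),
      |((fun ν : Measure (GaugeConfig d L G) => ν.bind (indepMH q fun U =>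
        ((∫ V, ∏ p : Plaquette d L, w (plaquetteHolonomy V p.1 p.2.1.1 p.2.1.2)
            ∂(Measure.pi fun _ : Edge d L => haarProbability G)) /
          ((∫ V, ∏ p ∈ B, w (plaquetteHolonomy V p.1 p.2.1.1 p.2.1.2)
            ∂(Measure.pi fun _ : Edge d L => haarProbability G)) *
            ∏ p ∈ Finset.univ \ B, w (plaquetteHolonomy U p.1 p.2.1.1 p.2.1.2)))⁻¹))^[n] μ).real A -
        π.real A| ≤ ε) ↔
      (1 - (∫ V, ∏ p : Plaquette d L, w (plaquetteHolonomy V p.1 p.2.1.1 p.2.1.2)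
          ∂(Measure.pi fun _ : Edge d L => haarProbability G)) /
        ((∫ g, w g ∂(haarProbability G)) ^ B.card * M ^ (Finset.univ \ B).card)) ^ n ≤ ε := by
  constructor
  · intro h
    have hatt := heatBath_uniform_rate_attained hd hL hw hm0 hm hM hw1 B t ht rank hrank π q hπ hq n
    rw [← hatt]
    exact h (Measure.dirac (fun _ : Edge d L => (1 : G))) {fun _ : Edge d L => (1 : G)}
  · intro h μ _ A
    exact (heatBath_uniform_rate hL hw hm0 hm hM hw1 B t ht rank hrank π q hπ hq μ n A).trans h

/-- **THE EXACT WORST-CASE MIXING PROFILE OF THE ALL-CLOSING CONDITIONER**: at time `t`, every start and every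
event are `ε`-close to `π` iff `(1 − Z/∏_{ℓ∈T} c_{#C_ℓ})^t ≤ ε`. [ours] -/
theorem allClosing_worstCase_le_iff [MeasurableSingletonClass G] [NullSingletonClass (haarProbability G)]
    (hd : 0 < d) (hL : 2 ≤ L) {w : G → ℝ} (hw : Continuous w) {m M : ℝ} (hm0 : 0 < m)
    (hm : ∀ g, m ≤ w g) (hM : ∀ g, w g ≤ M) (hwinv : ∀ g, w g⁻¹ = w g)
    (T : Finset (Edge d L)) (C : Edge d L → Finset (Plaquette d L))
    (hCne : ∀ ℓ ∈ T, (C ℓ).Nonempty)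
    (hCe : ∀ ℓ ∈ T, ∀ p ∈ C ℓ, ℓ ∈ ({(p.1, p.2.1.1), (p.1.shift p.2.1.1, p.2.1.2),
        (p.1.shift p.2.1.2, p.2.1.1), (p.1, p.2.1.2)} : Finset (Edge d L)))
    (hdisj : ∀ ℓ ∈ T, ∀ ℓ' ∈ T, ℓ ≠ ℓ' → Disjoint (C ℓ) (C ℓ'))
    (hcover : ∀ p : Plaquette d L, ∃ ℓ ∈ T, p ∈ C ℓ)
    (π q : Measure (GaugeConfig d L G)) [IsProbabilityMeasure π] [IsProbabilityMeasure q]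
    (hπ : π = (Measure.pi fun _ : Edge d L => haarProbability G).withDensity fun U =>
      ENNReal.ofReal ((∏ p : Plaquette d L, w (plaquetteHolonomy U p.1 p.2.1.1 p.2.1.2)) /
        ∫ V, ∏ p : Plaquette d L, w (plaquetteHolonomy V p.1 p.2.1.1 p.2.1.2) ∂(Measure.pi fun _ : Edge d L => haarProbability G)))
    (hq : q = (Measure.pi fun _ : Edge d L => haarProbability G).withDensity fun U =>
      ENNReal.ofReal (∏ ℓ ∈ T, (∏ p ∈ C ℓ, w (plaquetteHolonomy U p.1 p.2.1.1 p.2.1.2)) /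
          (∫ v, ∏ p ∈ C ℓ, w (plaquetteHolonomy (update U ℓ v) p.1 p.2.1.1 p.2.1.2) ∂(haarProbability G))))
    (n : ℕ) (ε : ℝ) :
    (∀ (μ : Measure (GaugeConfig d L G)) [IsProbabilityMeasure μ] (A : Set (GaugeConfig d L G)),
      |((fun ν : Measure (GaugeConfig d L G) => ν.bind (indepMH q fun U =>
        (((∫ V, ∏ p : Plaquette d L, w (plaquetteHolonomy V p.1 p.2.1.1 p.2.1.2) ∂(Measure.pi fun _ : Edge d L => haarProbability G)) /
          ∏ ℓ ∈ T, (∫ v, ∏ p ∈ C ℓ, w (plaquetteHolonomy (update U ℓ v) p.1 p.2.1.1 p.2.1.2) ∂(haarProbability G))))⁻¹))^[n] μ).real A -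
        π.real A| ≤ ε) ↔
      (1 - (∫ V, ∏ p : Plaquette d L, w (plaquetteHolonomy V p.1 p.2.1.1 p.2.1.2) ∂(Measure.pi fun _ : Edge d L => haarProbability G)) /
        ∏ ℓ ∈ T, ∫ h, w h ^ (C ℓ).card ∂(haarProbability G)) ^ n ≤ ε := by
  constructor
  · intro h
    have hatt := allClosing_uniform_rate_attained hd hL hw hm0 hm hM hwinv T C hCne hCe hdisj hcover π q hπ hq n
    rw [← hatt]
    exact h (Measure.dirac (fun _ : Edge d L => (1 : G))) {fun _ : Edge d L => (1 : G)}
  · intro h μ _ A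
    exact (allClosing_uniform_rate hL hw hm0 hm hM hwinv T C hCne hCe hdisj hcover π q hπ hq μ n A).trans h

end Summit.Ventures.LatticeQCDFlow.Theory2.Autoregressive

end
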